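/-
Copyright (c) 2026 the pub-hodgecm-mathlib formalisation cell (harness21).  Prover seat hodgecm-mathlib-K2Liu-p08 (g5), Track B «K2-LIT»,
#184♮ = hLiu418 = `stmt-HodgeConjecture-24832`; #42S organ S1, (G) organ ROW (ρ-mid): THE SCALAR OF THE MIDDLE-CELL PHASE — at the Levi-row point the trace
phase of ★ (C3-d) collapses to `ψ_v(s_t · q)`, `s_t = −im((𝕋₀ t)_{i₀i₀})`, `ι(q) = Q` (the frame hermitian norm).
-/
import Summits.HodgeConjecture.HodgeConjecture.Theorems.K2LiuWitnessPhaseTrace            -- ★ (Φ4)∕(i-b) letters: `gramS`, `quadraticLocalEquiv`, `re ∕ im`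
import Literature.NumberTheory.GelbartRogawski1991.LocalDoubledSiegelUnipotentAnisotropy     -- ★ `im_eq_zero_of_conjLocal_eq`
import HarnessLib

/-!
# Crux `HLiu418`, #42S organ S1, (ρ-mid): THE SCALAR OF THE MIDDLE-CELL PHASE AT A SINGLE-ENTRY GRAM

Cell `hodgecm-mathlib`, crux item hLiu418 = `stmt-HodgeConjecture-24832`; squad K2 ∕ K2Liu; LEAD F0P6-plan (g14); prover K2Liu-p08 (g5).
THEOREMS ONLY (no `def`, no instance, no notation, no named-fact hypothesis, no `sorry`); lane `--supports stmt-HodgeConjecture-24832 --as helper`.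

WHY.  ★ (C3-d) `K2LiuTensorMiddleCellPhaseTrace.halfForm_cOfFix_boxConj_eq_half_im_trace` writes the (C3) Levi row's phase as `ψ_v(−⅟2 · im_Q(2·tr(𝕋₀ · t · G̃(z))))`;
at the integration point `z = PD · (x₁ ⊔ 0)` ★ (C3-e) `K2LiuTensorMiddleCellPointReading.exists_pointReading` says the `Δ⁻`-reading has ONE non-zero row `i₀`, so the
Gram `G̃(z)` has ONE non-zero entry `(i₀, i₀) = Q` with `σ Q = Q` (the frame hermitian norm `ασβ + βσα + γσγ`).  THIS FILE extracts the scalar (generic doubled local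
currency `(F, E, c, δ, d, v, n, T₀)`):
* §1 `trace_mul_single_entry` — `tr(M · G) = M_{i₀i₀} · Q` for a single-entry `G`;
* §2 `toLocalRing_re_of_conjLocal_eq` — `σ Q = Q ⇒ ι(re Q) = Q` (★ `im_eq_zero_of_conjLocal_eq`, ★ `re_add_im`);
* §3 **`neg_half_im_two_mul_trace_single_entry`** — `−⅟2 · im_Q(2·tr(𝕋₀ t G)) = (−im((𝕋₀ t)_{i₀i₀})) · re Q`: the phase is `ψ_v(s_t · q)` with `s_t := −im((𝕋₀ t)_{i₀i₀})`
  (EXPLICIT in `t`, zero for `t = 0`) and `q := re Q`, `ι(q) = Q` — the input of ★ `K2LiuSplitMiddleProfileTransport.phase_eq_of_toLocalRing_eq` (split) ∕ ★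
  `K2LiuNonsplitTracePhase.tracePhase_eq_of_toPlace_eq` (non-split).
References: [Kudla1994] §3 Thm. 3.1; [GelbartRogawski1991] §3.1 p. 454; [Shimura1997] §13.2; [CasselsFrohlichANT1967] Ch. II §10.
HONEST LABEL.  Count-neutral helper: `HC_CM` is proved only modulo the 7 printed citations (2 remaining named inputs: hLiu418 = `stmt-HodgeConjecture-24832`,
h413 = `stmt-HodgeConjecture-24833`) until rung 0 closes.

## References
* [Kudla1994] S. S. Kudla, Israel J. Math. 87 (1994), §3 Thm. 3.1.  * [GelbartRogawski1991] S. Gelbart, J. Rogawski, Invent. Math. 105 (1991), §3.1.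
* [Shimura1997] G. Shimura, *Euler Products and Eisenstein Series*, CBMS 93 (1997), §13.2.
* [CasselsFrohlichANT1967] J. W. S. Cassels, A. Fröhlich (eds.), *Algebraic Number Theory* (1967), Ch. II §10.
-/

set_option autoImplicit false
set_option linter.dupNamespace false -- the mandated namespace repeats `HodgeConjecture.HodgeConjecture`

noncomputable section

open NumberField IsDedekindDomain Matrix
open Literature.NumberTheory.Automorphic Literature.NumberTheory.Automorphic.UnitaryGroup
open Literature.NumberTheory.Automorphic.UnitaryGroup.QuadraticCoordinates
open Literature.NumberTheory.GelbartRogawski1991.UnitaryDualPair Literature.NumberTheory.GelbartRogawski1991.UnitaryDualPair.LocalSplitting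

namespace Summit.HodgeConjecture.HodgeConjecture.Cruxes.HLiu418.K2LiuMiddleCellPhaseScalar

/-! ## §1 The trace against a single-entry matrix -/

/-- `tr(M · G) = M_{i₀i₀} · Q` when `G` has the single non-zero entry `G_{i₀i₀} = Q`. [folklore] -/
theorem trace_mul_single_entry {R : Type*} [CommRing R] {n : ℕ} (M G : Matrix (Fin n) (Fin n) R) (i₀ : Fin n) (Q : R)
    (hG : ∀ j i, G j i = if j = i₀ ∧ i = i₀ then Q else 0) :
    Matrix.trace (M * G) = M i₀ i₀ * Q := by
  rw [Matrix.trace]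
  simp only [Matrix.diag_apply, Matrix.mul_apply, hG]
  rw [Finset.sum_eq_single i₀ (fun j _ hj => Finset.sum_eq_zero fun i _ => by rw [if_neg (fun h => hj h.2), mul_zero])
    (fun h => absurd (Finset.mem_univ i₀) h)]
  rw [Finset.sum_eq_single i₀ (fun i _ hi => by rw [if_neg (fun h => hi h.1), mul_zero]) (fun h => absurd (Finset.mem_univ i₀) h),
    if_pos ⟨rfl, rfl⟩]

/-! ## §2 `σ`-fixed elements of `E ⊗ F_v` are base scalars -/

section Local

variable {F : Type} [Field F] [NumberField F] (E : Type) [Field E] [NumberField E] [Algebra F E]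
  [Algebra.IsQuadraticExtension F E] (c : E ≃ₐ[F] E) {δ : E} (hcδ : c δ = -δ) (hδ : δ ≠ 0) {d : F} (hd : δ * δ = algebraMap F E d)
  (v : HeightOneSpectrum (𝓞 F))

include hd in
/-- `σ Q = Q ⇒ ι_v(re Q) = Q` (★ `re_add_im` with `im Q = 0`). [cite: CasselsFrohlichANT1967, Ch. II §10] -/
theorem toLocalRing_re_of_conjLocal_eq {Q : LocalRing E v} (hQ : conjLocal E c v Q = Q) :
    toLocalRing E v (re (quadraticLocalEquiv E v c hcδ hδ).toLinearEquiv.toAddEquiv Q) = Q := by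
  have h := (isQuadraticCoordinates_local E v c hcδ hδ hd).re_add_im Q
  rw [im_eq_zero_of_conjLocal_eq (F := F) E c hcδ hδ hd v hQ, map_zero, zero_mul, add_zero] at h
  exact h

/-! ## §3 The phase scalar -/

include hd in
/-- **THE SCALAR OF THE MIDDLE-CELL PHASE**: for a single-entry Gram `G` (`G_{i₀i₀} = Q`, `σ Q = Q`, all other entries `0`) and any `t`,
`−⅟2 · im_Q(2 · tr(𝕋₀ · t · G)) = (−im((𝕋₀ · t)_{i₀i₀})) · re Q` — so the (C3) Levi-row phase at the point `PD · (x₁ ⊔ 0)` is `ψ_v(s_t · q)` with the EXPLICIT scalar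
`s_t := −im((𝕋₀ t)_{i₀i₀})` and `ι(q) = Q` (`toLocalRing_re_of_conjLocal_eq`).  (`im(τ · Q) = im τ · re Q` since `im Q = 0`, ★ `im_mul`.)
[cite: Kudla1994, §3 Thm. 3.1] [cite: GelbartRogawski1991, §3.1 p. 454] [cite: Shimura1997, §13.2] -/
theorem neg_half_im_two_mul_trace_single_entry {n : ℕ} (T₀ : Matrix (Fin n) (Fin n) F) (t G : Matrix (Fin n) (Fin n) (LocalRing E v))
    (i₀ : Fin n) (Q : LocalRing E v) (hQ : conjLocal E c v Q = Q) (hG : ∀ j i, G j i = if j = i₀ ∧ i = i₀ then Q else 0) :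
    -(⅟(2 : v.adicCompletion F) *
        im (quadraticLocalEquiv E v c hcδ hδ).toLinearEquiv.toAddEquiv (2 * Matrix.trace (gramS F E v n T₀ * t * G))) =
      (-(im (quadraticLocalEquiv E v c hcδ hδ).toLinearEquiv.toAddEquiv ((gramS F E v n T₀ * t) i₀ i₀))) *
        re (quadraticLocalEquiv E v c hcδ hδ).toLinearEquiv.toAddEquiv Q := by
  rw [trace_mul_single_entry _ G i₀ Q hG, two_mul, map_add,
    (isQuadraticCoordinates_local E v c hcδ hδ hd).im_mul, im_eq_zero_of_conjLocal_eq (F := F) E c hcδ hδ hd v hQ, mul_zero, zero_add, ← two_mul,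
    ← mul_assoc, invOf_mul_self, one_mul, neg_mul]

end Local

end Summit.HodgeConjecture.HodgeConjecture.Cruxes.HLiu418.K2LiuMiddleCellPhaseScalar

end
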